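import Summits.AtomisticToContinuum.HydrodynamicLimit.Theorems.CollisionIsometryCLTAdaptedWeightCLTBHEntropyBudgetGauss

/-!
# Entropy budget (stub `stub_entropyBudget`, line `block-h-dissipation-closure`, crux `AdaptedWeightCLT`,
stmt-AtomisticToContinuum-14868; `--supports`) — helper 2: statics of the regularised cell law

Deterministic facts about the line's cell objects `cw cW cU cT kde cellLaw cellEnt` (vocabulary
`…Theorems.BlockHDissipation`) at ONE configuration `w` and ONE location `x`, for a nonnegative kernel
(`0 ≤ ψ_N`), `h > 0`, `0 < δ ≤ 1`, and any velocity bound `V ≥ |v_i|`: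
* weights: `0 ≤ cw_i ≤ cW`, empty cells (`cW = 0`) have all `cw_i = 0`; `|ū| ≤ V`; `0 ≤ θ̄ ≤ (2V)²/3`;
  the VARIANCE BOUND `cW θ̄ ≤ Σ_i cw_i |v_i|²/3`;
* the KDE `f̃ = cW⁻¹ Σ cw_i G_h(· − v_i)`: `0 ≤ f̃ ≤ (2πh²)^{-3/2}`, `∫ f̃ = 1` (non-empty cell), `f̃ = 0` (empty),
  `∫ f̃ |v − ū|² = 3h² + 3θ̄`;
* the regularised law `f̂ = (1−δ) f̃ + δ M_{θ̄+h²,ū}`: `δ M ≤ f̂ ≤ (2πh²)^{-3/2}`, `∫ f̂ = 1` (resp. `δ`),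
  `∫ f̂ |v−ū|² ≤ 3(θ̄+h²)`, the two-sided LOG BOUND `|log f̂(v)| ≤ Λ + |v−ū|²/(2h²)`, integrability of
  `f̂ log f̂`;
* the cell entropy: `|H(f̂_x)| ≤ |log (2πh²)^{-3/2}| + |log δ| + (3/2)|log 2π(θ̄+h²)| + 3/2` and the
  MASS-WEIGHTED bound `|cW · H(f̂_x)| ≤ C(h,δ) cW + π Σ_i cw_i |v_i|²` behind `|S_N| ≤ C + π KE/(N+1)`.
-/

namespace Summit.AtomisticToContinuum.HydrodynamicLimit.Theorems.BlockHDissipation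

open scoped BigOperators Topology Classical MeasureTheory ENNReal InnerProductSpace
open Filter Set MeasureTheory
open Literature.Analysis.FluidPDE
open Summit.AtomisticToContinuum.HydrodynamicLimit.Theorems.ContactSourceDuhamel (T3 V3 Cfg Vel Flow Flows)
open Literature.MathematicalPhysics.KineticTheory (localMaxwellian_pos localMaxwellian_nonneg continuous_localMaxwellian)

noncomputable section

namespace EntropyBudget

variable {N : ℕ} {ψ : ℕ → T3 → ℝ} {h δ V : ℝ} (w : Cfg N) (x : T3)

/-! ## Weights, cell velocity, cell temperature -/

/-- `0 ≤ cw_i` for a nonnegative kernel. -/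
theorem cw_nonneg (hψ : ∀ y, 0 ≤ ψ N y) (i : Fin (N + 1)) : 0 ≤ cw N ψ w x i := hψ _

/-- `0 ≤ cW`. -/
theorem cW_nonneg (hψ : ∀ y, 0 ≤ ψ N y) : 0 ≤ cW N ψ w x :=
  Finset.sum_nonneg fun i _ => cw_nonneg w x hψ i

/-- `cw_i ≤ cW`. -/
theorem cw_le_cW (hψ : ∀ y, 0 ≤ ψ N y) (i : Fin (N + 1)) : cw N ψ w x i ≤ cW N ψ w x :=
  Finset.single_le_sum (f := fun j => cw N ψ w x j) (fun j _ => cw_nonneg w x hψ j) (Finset.mem_univ i)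

/-- In an empty cell (`cW = 0`) every weight vanishes. -/
theorem cw_eq_zero_of_cW (hψ : ∀ y, 0 ≤ ψ N y) (hS : cW N ψ w x = 0) (i : Fin (N + 1)) : cw N ψ w x i = 0 :=
  le_antisymm (hS ▸ cw_le_cW w x hψ i) (cw_nonneg w x hψ i)

/-- A velocity bound is nonnegative. -/
theorem V_nonneg (hV : ∀ i, ‖(w i).2‖ ≤ V) : 0 ≤ V := (norm_nonneg _).trans (hV 0)

/-- CELL VELOCITY BOUND: `|ū_x| ≤ V` (a convex combination of the `v_i`; junk `0` on an empty cell). -/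
theorem norm_cU_le (hψ : ∀ y, 0 ≤ ψ N y) (hV : ∀ i, ‖(w i).2‖ ≤ V) : ‖cU N ψ w x‖ ≤ V := by
  have hV0 := V_nonneg w hV
  by_cases hS : cW N ψ w x = 0
  · simp [cU, hS, hV0]
  have hSpos : 0 < cW N ψ w x := lt_of_le_of_ne (cW_nonneg w x hψ) (Ne.symm hS)
  unfold cU
  rw [norm_smul, Real.norm_eq_abs, abs_of_pos (inv_pos.2 hSpos), inv_mul_le_iff₀ hSpos]
  calc ‖∑ i, cw N ψ w x i • (w i).2‖ ≤ ∑ i, ‖cw N ψ w x i • (w i).2‖ := norm_sum_le _ _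
    _ ≤ ∑ i, cw N ψ w x i * V := Finset.sum_le_sum fun i _ => by
        rw [norm_smul, Real.norm_eq_abs, abs_of_nonneg (cw_nonneg w x hψ i)]
        exact mul_le_mul_of_nonneg_left (hV i) (cw_nonneg w x hψ i)
    _ = cW N ψ w x * V := by rw [← Finset.sum_mul]; rfl

/-- `0 ≤ θ̄_x`. -/
theorem cT_nonneg (hψ : ∀ y, 0 ≤ ψ N y) : 0 ≤ cT N ψ w x :=
  mul_nonneg (inv_nonneg.2 (cW_nonneg w x hψ))
    (Finset.sum_nonneg fun i _ => mul_nonneg (cw_nonneg w x hψ i) (by positivity))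

/-- `h² ≤ θ̄ + h²` and `0 < θ̄ + h²`. -/
theorem h2_le_theta (hψ : ∀ y, 0 ≤ ψ N y) : h ^ 2 ≤ cT N ψ w x + h ^ 2 :=
  le_add_of_nonneg_left (cT_nonneg w x hψ)

/-- `0 < θ̄ + h²`. -/
theorem theta_pos (hψ : ∀ y, 0 ≤ ψ N y) (hh : 0 < h) : 0 < cT N ψ w x + h ^ 2 :=
  lt_of_lt_of_le (by positivity) (h2_le_theta w x hψ)

/-- `|v_i − ū| ≤ 2V`. -/
theorem norm_vel_sub_cU_le (hψ : ∀ y, 0 ≤ ψ N y) (hV : ∀ i, ‖(w i).2‖ ≤ V) (i : Fin (N + 1)) :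
    ‖(w i).2 - cU N ψ w x‖ ≤ 2 * V :=
  calc ‖(w i).2 - cU N ψ w x‖ ≤ ‖(w i).2‖ + ‖cU N ψ w x‖ := norm_sub_le _ _
    _ ≤ V + V := add_le_add (hV i) (norm_cU_le w x hψ hV)
    _ = 2 * V := by ring

/-- CELL TEMPERATURE BOUND: `θ̄_x ≤ (2V)²/3`. -/
theorem cT_le (hψ : ∀ y, 0 ≤ ψ N y) (hV : ∀ i, ‖(w i).2‖ ≤ V) : cT N ψ w x ≤ (2 * V) ^ 2 / 3 := by
  by_cases hS : cW N ψ w x = 0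
  · have : cT N ψ w x = 0 := by simp [cT, hS]
    rw [this]; positivity
  have hSpos : 0 < cW N ψ w x := lt_of_le_of_ne (cW_nonneg w x hψ) (Ne.symm hS)
  unfold cT
  rw [inv_mul_le_iff₀ hSpos]
  calc ∑ i, cw N ψ w x i * (‖(w i).2 - cU N ψ w x‖ ^ 2 / 3) ≤ ∑ i, cw N ψ w x i * ((2 * V) ^ 2 / 3) :=
        Finset.sum_le_sum fun i _ => mul_le_mul_of_nonneg_left
          (div_le_div_of_nonneg_right (pow_le_pow_left₀ (norm_nonneg _) (norm_vel_sub_cU_le w x hψ hV i) 2)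
            (by norm_num)) (cw_nonneg w x hψ i)
    _ = cW N ψ w x * ((2 * V) ^ 2 / 3) := by rw [← Finset.sum_mul]; rfl

/-- The weighted momentum is `cW • ū` (trivially in an empty cell, where both vanish). -/
theorem sum_cw_smul_vel (hψ : ∀ y, 0 ≤ ψ N y) : ∑ i, cw N ψ w x i • (w i).2 = cW N ψ w x • cU N ψ w x := by
  by_cases hS : cW N ψ w x = 0
  · rw [hS, zero_smul]
    exact Finset.sum_eq_zero fun i _ => by rw [cw_eq_zero_of_cW w x hψ hS i, zero_smul]
  · unfold cU
    rw [smul_smul, mul_inv_cancel₀ hS, one_smul]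

/-- VARIANCE BOUND: `cW θ̄ ≤ Σ_i cw_i |v_i|²/3` (the weighted variance is at most the second moment). -/
theorem cW_mul_cT_le (hψ : ∀ y, 0 ≤ ψ N y) :
    cW N ψ w x * cT N ψ w x ≤ (∑ i, cw N ψ w x i * ‖(w i).2‖ ^ 2) / 3 := by
  by_cases hS : cW N ψ w x = 0
  · rw [hS, zero_mul]
    exact div_nonneg (Finset.sum_nonneg fun i _ => mul_nonneg (cw_nonneg w x hψ i) (sq_nonneg _)) (by norm_num)
  unfold cT
  rw [← mul_assoc, mul_inv_cancel₀ hS, one_mul]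
  have hkey : ∑ i, cw N ψ w x i * ‖(w i).2 - cU N ψ w x‖ ^ 2 ≤ ∑ i, cw N ψ w x i * ‖(w i).2‖ ^ 2 := by
    have hexp : ∀ i, cw N ψ w x i * ‖(w i).2 - cU N ψ w x‖ ^ 2 = cw N ψ w x i * ‖(w i).2‖ ^ 2 -
        2 * ⟪cw N ψ w x i • (w i).2, cU N ψ w x⟫_ℝ + cw N ψ w x i * ‖cU N ψ w x‖ ^ 2 := by
      intro i
      rw [norm_sub_sq_real, real_inner_smul_left]
      ring
    simp_rw [hexp]
    rw [Finset.sum_add_distrib, Finset.sum_sub_distrib, ← Finset.mul_sum, ← sum_inner,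
      sum_cw_smul_vel w x hψ, real_inner_smul_left, real_inner_self_eq_norm_sq, ← Finset.sum_mul]
    have : (∑ i, cw N ψ w x i) = cW N ψ w x := rfl
    rw [this]
    nlinarith [cW_nonneg w x hψ, sq_nonneg ‖cU N ψ w x‖]
  have h3 : ∑ i, cw N ψ w x i * (‖(w i).2 - cU N ψ w x‖ ^ 2 / 3) =
      (∑ i, cw N ψ w x i * ‖(w i).2 - cU N ψ w x‖ ^ 2) / 3 := by
    rw [Finset.sum_div]
    exact Finset.sum_congr rfl fun i _ => by ring
  rw [h3]
  exact div_le_div_of_nonneg_right hkey (by norm_num)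

/-! ## The kernel density estimate -/

/-- `0 ≤ f̃`. -/
theorem kde_nonneg (hψ : ∀ y, 0 ≤ ψ N y) (hh : 0 < h) (v : V3) : 0 ≤ kde N ψ h w x v :=
  mul_nonneg (inv_nonneg.2 (cW_nonneg w x hψ))
    (Finset.sum_nonneg fun i _ => mul_nonneg (cw_nonneg w x hψ i) (gauss_pos hh _ _).le)

/-- `f̃ ≤ (2πh²)^{-3/2}`. -/
theorem kde_le_gMax (hψ : ∀ y, 0 ≤ ψ N y) (hh : 0 < h) (v : V3) :
    kde N ψ h w x v ≤ (2 * Real.pi * h ^ 2) ^ (-(3 : ℝ) / 2) := by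
  by_cases hS : cW N ψ w x = 0
  · have : kde N ψ h w x v = 0 := by simp [kde, hS]
    rw [this]; exact (gMax_pos hh).le
  have hSpos : 0 < cW N ψ w x := lt_of_le_of_ne (cW_nonneg w x hψ) (Ne.symm hS)
  unfold kde
  rw [inv_mul_le_iff₀ hSpos]
  calc ∑ i, cw N ψ w x i * gauss h (w i).2 v ≤ ∑ i, cw N ψ w x i * (2 * Real.pi * h ^ 2) ^ (-(3 : ℝ) / 2) :=
        Finset.sum_le_sum fun i _ => mul_le_mul_of_nonneg_left (gauss_le_gMax hh _ _) (cw_nonneg w x hψ i)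
    _ = cW N ψ w x * (2 * Real.pi * h ^ 2) ^ (-(3 : ℝ) / 2) := by rw [← Finset.sum_mul]; rfl

/-- In an empty cell the KDE is the junk value `0`. -/
theorem kde_of_cW_eq_zero (hS : cW N ψ w x = 0) (v : V3) : kde N ψ h w x v = 0 := by simp [kde, hS]

/-- `f̃` is continuous in the velocity. -/
theorem continuous_kde : Continuous (kde N ψ h w x) := by
  unfold kde gauss
  exact continuous_const.mul (continuous_finsetSum _ fun i _ =>
    continuous_const.mul (continuous_localMaxwellian 1 (h ^ 2) (w i).2))

/-- LINEARITY OF THE KDE INTEGRALS: `∫ f̃ g = cW⁻¹ Σ_i cw_i ∫ G_h(· − v_i) g` when each `G_h(· − v_i) g` is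
integrable. -/
theorem integral_kde_mul {g : V3 → ℝ} (hg : ∀ i, Integrable fun v => gauss h (w i).2 v * g v) :
    ∫ v, kde N ψ h w x v * g v = (cW N ψ w x)⁻¹ * ∑ i, cw N ψ w x i * ∫ v, gauss h (w i).2 v * g v := by
  have e : (fun v => kde N ψ h w x v * g v) =
      fun v => (cW N ψ w x)⁻¹ * ∑ i, cw N ψ w x i * (gauss h (w i).2 v * g v) := by
    funext v
    simp only [kde, Finset.sum_mul, Finset.mul_sum]
    exact Finset.sum_congr rfl fun i _ => by ring
  rw [e, integral_const_mul, integral_finsetSum _ fun i _ => (hg i).const_mul _]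
  congr 1
  exact Finset.sum_congr rfl fun i _ => integral_const_mul _ _

/-- `f̃ g` is integrable when each `G_h(· − v_i) g` is. -/
theorem integrable_kde_mul {g : V3 → ℝ} (hg : ∀ i, Integrable fun v => gauss h (w i).2 v * g v) :
    Integrable fun v => kde N ψ h w x v * g v := by
  have e : (fun v => kde N ψ h w x v * g v) =
      fun v => (cW N ψ w x)⁻¹ * ∑ i, cw N ψ w x i * (gauss h (w i).2 v * g v) := by
    funext v
    simp only [kde, Finset.sum_mul, Finset.mul_sum]
    exact Finset.sum_congr rfl fun i _ => by ring
  rw [e]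
  exact (integrable_finsetSum _ fun i _ => (hg i).const_mul _).const_mul _

/-- UNIT MASS of the KDE in a non-empty cell: `∫ f̃ = 1`. -/
theorem integral_kde (hh : 0 < h) (hS : cW N ψ w x ≠ 0) : ∫ v, kde N ψ h w x v = 1 := by
  have hh2 : 0 < h ^ 2 := by positivity
  have hint : ∀ i, Integrable fun v => gauss h (w i).2 v * (1 : ℝ) := fun i => by
    simp_rw [mul_one]; exact integrable_lM hh2 (w i).2
  have h1 := integral_kde_mul (ψ := ψ) w x (g := fun _ => (1 : ℝ)) hint
  simp only [mul_one] at h1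
  rw [h1]
  have : ∀ i, ∫ v, gauss h (w i).2 v = 1 := fun i => integral_lM hh2 _
  simp_rw [this, mul_one]
  exact inv_mul_cancel₀ hS

/-- SECOND MOMENT of the KDE about the cell velocity (non-empty cell): `∫ f̃ |v − ū|² = 3h² + 3θ̄`. -/
theorem integral_kde_mul_norm_sub_cU_sq (hh : 0 < h) (hS : cW N ψ w x ≠ 0) :
    ∫ v, kde N ψ h w x v * ‖v - cU N ψ w x‖ ^ 2 = 3 * h ^ 2 + 3 * cT N ψ w x := by
  have hh2 : 0 < h ^ 2 := by positivity
  rw [integral_kde_mul w x fun i => integrable_lM_mul_norm_sub_pow hh2 _ _ 2]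
  have : ∀ i, ∫ v, gauss h (w i).2 v * ‖v - cU N ψ w x‖ ^ 2 = 3 * h ^ 2 + ‖(w i).2 - cU N ψ w x‖ ^ 2 :=
    fun i => integral_lM_mul_norm_sub_sq' hh2 _ _
  simp_rw [this, mul_add, Finset.sum_add_distrib, ← Finset.sum_mul]
  have hW : (∑ i, cw N ψ w x i) = cW N ψ w x := rfl
  rw [hW, mul_add, ← mul_assoc, inv_mul_cancel₀ hS, one_mul]
  unfold cT
  rw [Finset.mul_sum, Finset.mul_sum, Finset.mul_sum]
  congr 1
  exact Finset.sum_congr rfl fun i _ => by ring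


/-! ## The regularised cell law `f̂ = (1 − δ) f̃ + δ M_{θ̄+h²,ū}` -/

/-- The floor is below the law: `δ M_{θ̄+h²,ū}(v) ≤ f̂(v)`. -/
theorem delta_lM_le_cellLaw (hψ : ∀ y, 0 ≤ ψ N y) (hh : 0 < h) (hδ1 : δ ≤ 1) (v : V3) :
    δ * localMaxwellian 1 (cT N ψ w x + h ^ 2) (cU N ψ w x) v ≤ cellLaw N ψ h δ w x v := by
  unfold cellLaw
  have : 0 ≤ (1 - δ) * kde N ψ h w x v := mul_nonneg (by linarith) (kde_nonneg w x hψ hh v)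
  linarith

/-- `0 < f̂`. -/
theorem cellLaw_pos (hψ : ∀ y, 0 ≤ ψ N y) (hh : 0 < h) (hδ : 0 < δ) (hδ1 : δ ≤ 1) (v : V3) :
    0 < cellLaw N ψ h δ w x v :=
  lt_of_lt_of_le (mul_pos hδ (localMaxwellian_pos one_pos (theta_pos w x hψ hh) _ _))
    (delta_lM_le_cellLaw w x hψ hh hδ1 v)

/-- `f̂ ≤ (2πh²)^{-3/2}`. -/
theorem cellLaw_le_gMax (hψ : ∀ y, 0 ≤ ψ N y) (hh : 0 < h) (hδ : 0 ≤ δ) (hδ1 : δ ≤ 1) (v : V3) :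
    cellLaw N ψ h δ w x v ≤ (2 * Real.pi * h ^ 2) ^ (-(3 : ℝ) / 2) := by
  unfold cellLaw
  have h1 := kde_le_gMax w x hψ hh v
  have h2 := lM_le_gMax hh (h2_le_theta w x hψ) (cU N ψ w x) v
  nlinarith

/-- UPPER LOG BOUND: `log f̂(v) ≤ log (2πh²)^{-3/2}`. -/
theorem log_cellLaw_le (hψ : ∀ y, 0 ≤ ψ N y) (hh : 0 < h) (hδ : 0 < δ) (hδ1 : δ ≤ 1) (v : V3) :
    Real.log (cellLaw N ψ h δ w x v) ≤ Real.log ((2 * Real.pi * h ^ 2) ^ (-(3 : ℝ) / 2)) :=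
  Real.log_le_log (cellLaw_pos w x hψ hh hδ hδ1 v) (cellLaw_le_gMax w x hψ hh hδ.le hδ1 v)

/-- LOWER LOG BOUND (exact temperature): `log δ − (3/2) log 2π(θ̄+h²) − |v − ū|²/(2(θ̄+h²)) ≤ log f̂(v)`. -/
theorem log_cellLaw_ge (hψ : ∀ y, 0 ≤ ψ N y) (hh : 0 < h) (hδ : 0 < δ) (hδ1 : δ ≤ 1) (v : V3) :
    Real.log δ + (-(3 / 2) * Real.log (2 * Real.pi * (cT N ψ w x + h ^ 2)) -
      ‖v - cU N ψ w x‖ ^ 2 / (2 * (cT N ψ w x + h ^ 2))) ≤ Real.log (cellLaw N ψ h δ w x v) := by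
  have hθ := theta_pos w x hψ hh
  have hM := localMaxwellian_pos one_pos hθ (cU N ψ w x) v
  calc Real.log δ + (-(3 / 2) * Real.log (2 * Real.pi * (cT N ψ w x + h ^ 2)) -
        ‖v - cU N ψ w x‖ ^ 2 / (2 * (cT N ψ w x + h ^ 2)))
      ≤ Real.log δ + Real.log (localMaxwellian 1 (cT N ψ w x + h ^ 2) (cU N ψ w x) v) :=
        add_le_add le_rfl (log_lM_ge' hθ _ v)
    _ = Real.log (δ * localMaxwellian 1 (cT N ψ w x + h ^ 2) (cU N ψ w x) v) :=
        (Real.log_mul hδ.ne' hM.ne').symm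
    _ ≤ Real.log (cellLaw N ψ h δ w x v) :=
        Real.log_le_log (mul_pos hδ hM) (delta_lM_le_cellLaw w x hψ hh hδ1 v)

/-- TWO-SIDED LOG BOUND: `|log f̂(v)| ≤ Λ + |v − ū|²/(2h²)`,
`Λ = |log (2πh²)^{-3/2}| + |log δ| + (3/2)|log 2π(θ̄+h²)|`. -/
theorem abs_log_cellLaw_le (hψ : ∀ y, 0 ≤ ψ N y) (hh : 0 < h) (hδ : 0 < δ) (hδ1 : δ ≤ 1) (v : V3) :
    |Real.log (cellLaw N ψ h δ w x v)| ≤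
      (|Real.log ((2 * Real.pi * h ^ 2) ^ (-(3 : ℝ) / 2))| + |Real.log δ| +
        3 / 2 * |Real.log (2 * Real.pi * (cT N ψ w x + h ^ 2))|) + ‖v - cU N ψ w x‖ ^ 2 / (2 * h ^ 2) := by
  have hup := log_cellLaw_le w x hψ hh hδ hδ1 v
  have hlo := log_cellLaw_ge w x hψ hh hδ hδ1 v
  have hq : ‖v - cU N ψ w x‖ ^ 2 / (2 * (cT N ψ w x + h ^ 2)) ≤ ‖v - cU N ψ w x‖ ^ 2 / (2 * h ^ 2) :=
    div_le_div_of_nonneg_left (sq_nonneg _) (by positivity) (by linarith [h2_le_theta (h := h) w x hψ])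
  rw [abs_le]
  constructor
  · have h1 := neg_abs_le (Real.log δ)
    have h2 := le_abs_self (Real.log (2 * Real.pi * (cT N ψ w x + h ^ 2)))
    have h3 := abs_nonneg (Real.log ((2 * Real.pi * h ^ 2) ^ (-(3 : ℝ) / 2)))
    linarith
  · have h1 := le_abs_self (Real.log ((2 * Real.pi * h ^ 2) ^ (-(3 : ℝ) / 2)))
    have h2 := abs_nonneg (Real.log δ)
    have h3 := abs_nonneg (Real.log (2 * Real.pi * (cT N ψ w x + h ^ 2)))
    have h4 : 0 ≤ ‖v - cU N ψ w x‖ ^ 2 / (2 * h ^ 2) := by positivity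
    linarith

/-- `f̂` is continuous in the velocity. -/
theorem continuous_cellLaw : Continuous (cellLaw N ψ h δ w x) := by
  unfold cellLaw
  exact (continuous_const.mul (continuous_kde w x)).add
    (continuous_const.mul (continuous_localMaxwellian 1 _ _))

/-- LINEARITY OF THE `f̂`-INTEGRALS: `∫ f̂ g = (1−δ) ∫ f̃ g + δ ∫ M g`. -/
theorem integral_cellLaw_mul {g : V3 → ℝ}
    (hg : ∀ i, Integrable fun v => gauss h (w i).2 v * g v)
    (hM : Integrable fun v => localMaxwellian 1 (cT N ψ w x + h ^ 2) (cU N ψ w x) v * g v) :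
    ∫ v, cellLaw N ψ h δ w x v * g v = (1 - δ) * (∫ v, kde N ψ h w x v * g v) +
      δ * ∫ v, localMaxwellian 1 (cT N ψ w x + h ^ 2) (cU N ψ w x) v * g v := by
  have e : (fun v => cellLaw N ψ h δ w x v * g v) = fun v => (1 - δ) * (kde N ψ h w x v * g v) +
      δ * (localMaxwellian 1 (cT N ψ w x + h ^ 2) (cU N ψ w x) v * g v) := by
    funext v; simp only [cellLaw]; ring
  rw [e, integral_add ((integrable_kde_mul w x hg).const_mul _) (hM.const_mul _), integral_const_mul,
    integral_const_mul]

/-- `f̂ g` is integrable when each `G_h(· − v_i) g` and `M g` are. -/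
theorem integrable_cellLaw_mul {g : V3 → ℝ} (hg : ∀ i, Integrable fun v => gauss h (w i).2 v * g v)
    (hM : Integrable fun v => localMaxwellian 1 (cT N ψ w x + h ^ 2) (cU N ψ w x) v * g v) :
    Integrable fun v => cellLaw N ψ h δ w x v * g v := by
  have e : (fun v => cellLaw N ψ h δ w x v * g v) = fun v => (1 - δ) * (kde N ψ h w x v * g v) +
      δ * (localMaxwellian 1 (cT N ψ w x + h ^ 2) (cU N ψ w x) v * g v) := by
    funext v; simp only [cellLaw]; ring
  rw [e]
  exact ((integrable_kde_mul w x hg).const_mul _).add (hM.const_mul _)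

/-- A polynomial weight against a Maxwellian is integrable: `M_{θ,u} · (A + B |v − c|^k)`. -/
theorem integrable_lM_mul_poly {θ : ℝ} (hθ : 0 < θ) (u : V3) (A B : ℝ) (c : V3) (k : ℕ) :
    Integrable fun v => localMaxwellian 1 θ u v * (A + B * ‖v - c‖ ^ k) :=
  integrable_lM_mul_of_norm_le hθ u c (by fun_prop) fun v => by
    rw [Real.norm_eq_abs]
    calc |A + B * ‖v - c‖ ^ k| ≤ |A| + |B * ‖v - c‖ ^ k| := abs_add_le _ _
      _ = |A| + |B| * ‖v - c‖ ^ k := by rw [abs_mul, abs_of_nonneg (pow_nonneg (norm_nonneg _) k)]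

/-- `f̂ · (A + B |v − c|^k)` is integrable (polynomial weights). -/
theorem integrable_cellLaw_mul_poly (hψ : ∀ y, 0 ≤ ψ N y) (hh : 0 < h) (A B : ℝ) (c : V3) (k : ℕ) :
    Integrable fun v => cellLaw N ψ h δ w x v * (A + B * ‖v - c‖ ^ k) :=
  integrable_cellLaw_mul w x (fun i => integrable_lM_mul_poly (by positivity : 0 < h ^ 2) (w i).2 A B c k)
    (integrable_lM_mul_poly (theta_pos w x hψ hh) _ A B c k)

/-- `f̂` is integrable. -/
theorem integrable_cellLaw (hψ : ∀ y, 0 ≤ ψ N y) (hh : 0 < h) : Integrable (cellLaw N ψ h δ w x) := by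
  have := integrable_cellLaw_mul_poly (δ := δ) w x hψ hh 1 0 0 0
  simpa using this

/-- MASS of the regularised law: `∫ f̂ = 1` in a non-empty cell. -/
theorem integral_cellLaw (hψ : ∀ y, 0 ≤ ψ N y) (hh : 0 < h) (hS : cW N ψ w x ≠ 0) :
    ∫ v, cellLaw N ψ h δ w x v = 1 := by
  have hh2 : 0 < h ^ 2 := by positivity
  have h1 := integral_cellLaw_mul (ψ := ψ) (δ := δ) w x (g := fun _ => (1 : ℝ))
    (fun i => by simp_rw [mul_one]; exact integrable_lM hh2 (w i).2)
    (by simp_rw [mul_one]; exact integrable_lM (theta_pos w x hψ hh) _)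
  simp only [mul_one] at h1
  rw [h1, integral_kde w x hh hS, integral_lM (theta_pos w x hψ hh)]
  ring

/-- MASS of the regularised law: `∫ f̂ = δ` in an empty cell. -/
theorem integral_cellLaw_of_cW_eq_zero (hψ : ∀ y, 0 ≤ ψ N y) (hh : 0 < h) (hS : cW N ψ w x = 0) :
    ∫ v, cellLaw N ψ h δ w x v = δ := by
  have e : (fun v => cellLaw N ψ h δ w x v) =
      fun v => δ * localMaxwellian 1 (cT N ψ w x + h ^ 2) (cU N ψ w x) v := by
    funext v; simp [cellLaw, kde_of_cW_eq_zero w x hS]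
  rw [e, integral_const_mul, integral_lM (theta_pos w x hψ hh), mul_one]

/-- `0 ≤ ∫ f̂ ≤ 1`. -/
theorem integral_cellLaw_mem (hψ : ∀ y, 0 ≤ ψ N y) (hh : 0 < h) (hδ : 0 ≤ δ) (hδ1 : δ ≤ 1) :
    0 ≤ ∫ v, cellLaw N ψ h δ w x v ∧ ∫ v, cellLaw N ψ h δ w x v ≤ 1 := by
  by_cases hS : cW N ψ w x = 0
  · rw [integral_cellLaw_of_cW_eq_zero w x hψ hh hS]; exact ⟨hδ, hδ1⟩
  · rw [integral_cellLaw w x hψ hh hS]; exact ⟨zero_le_one, le_rfl⟩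

/-- SECOND MOMENT about the cell velocity: `∫ f̂ |v − ū|² ≤ 3(θ̄ + h²)` (equality in a non-empty cell). -/
theorem integral_cellLaw_mul_norm_sub_sq_le (hψ : ∀ y, 0 ≤ ψ N y) (hh : 0 < h) (hδ1 : δ ≤ 1) :
    ∫ v, cellLaw N ψ h δ w x v * ‖v - cU N ψ w x‖ ^ 2 ≤ 3 * (cT N ψ w x + h ^ 2) := by
  have hh2 : 0 < h ^ 2 := by positivity
  have hθ := theta_pos w x hψ hh
  rw [integral_cellLaw_mul (δ := δ) w x (fun i => integrable_lM_mul_norm_sub_pow hh2 _ _ 2)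
    (integrable_lM_mul_norm_sub_pow hθ _ _ 2), integral_lM_mul_norm_sub_sq' hθ, sub_self, norm_zero]
  by_cases hS : cW N ψ w x = 0
  · have h0 : ∫ v, kde N ψ h w x v * ‖v - cU N ψ w x‖ ^ 2 = 0 := by
      have : (fun v => kde N ψ h w x v * ‖v - cU N ψ w x‖ ^ 2) = fun _ => 0 := by
        funext v; rw [kde_of_cW_eq_zero w x hS, zero_mul]
      rw [this, integral_zero]
    rw [h0]
    nlinarith [cT_nonneg w x hψ]
  · have h0 := integral_kde_mul_norm_sub_cU_sq w x hh hS
    rw [h0]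
    nlinarith

end EntropyBudget

/-- Registered anchor of this helper file (`--supports stmt-AtomisticToContinuum-14868`, helper of
`stub_entropyBudget`): the second moment of the regularised cell law about the cell velocity. -/
theorem bhEntropyBudget_cellLaw_anchor : ∀ (N : ℕ) (ψ : ℕ → T3 → ℝ) (h δ : ℝ) (w : Cfg N) (x : T3), (∀ y, 0 ≤ ψ N y) → 0 < h → δ ≤ 1 → ∫ v, cellLaw N ψ h δ w x v * ‖v - cU N ψ w x‖ ^ 2 ≤ 3 * (cT N ψ w x + h ^ 2) :=
  fun _ _ _ _ w x hψ hh hδ1 => EntropyBudget.integral_cellLaw_mul_norm_sub_sq_le w x hψ hh hδ1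

end

end Summit.AtomisticToContinuum.HydrodynamicLimit.Theorems.BlockHDissipation
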